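import Literature.Analysis.FluidPDE.PeriodicCylinderCellC1Half
import Literature.Analysis.FluidPDE.PeriodicCylinderSobolevHolder
import HarnessLib

/-!
# `W^{3,2} ⊂ C^{1,1/2}` on the periodic cylinder: the Hölder modulus and the sup of the derivative
of smooth periodic fields

Topic `Literature/Analysis/FluidPDE`. Proved results (no named facts). For a field `v` smooth on
the closed cylinder `{r ≤ 1}` and `L`-periodic in `z` — the slices of the smooth periodic Euler
class `IsPeriodicCylinderEulerSolution` and the fields of the stationary facts
`ShirotaYanagisawa1993_periodicCylinder(Delta)LogDivCurlEstimate` — the Sobolev imbedding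
`W^{3,2} ⊂ C^{1,1/2}` of the period cell (`cylinderCell_fderiv_holderHalf`,
`cylinderCell_norm_fderiv_le`; Adams, *Sobolev Spaces* (1975), Thm. 5.4 Part II Case C' (9) and
Part I Case C (8)) is carried over to the whole infinite open cylinder `{r < 1}`:

* `periodicCylinder_fderiv_holderHalf_norm_le` — there is `C = C(L)` such that
  `‖Dv(x) − Dv(y)‖ ≤ C n |x − y|^{1/2}` and `‖Dv(x)‖ ≤ C n` for all `x, y` with `r < 1`, whenever
  `‖v‖_{W^{3,2}(cell)} ≤ n`.

Proof. `Dv` is `L`-periodic (`IsAxiallyPeriodic.fderiv`) and continuous on `{r < 1}`, so the cell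
bounds extend to the closed slab `{r < 1, 0 ≤ z ≤ L}` by continuity (shrinking towards the
mid-height `z = L/2` moves the slab into the open cell) and to every slab
`{r < 1, jL ≤ z ≤ (j+1)L}` by periodicity; two points of `{r < 1}` at distance `< L` lie in the
same slab or in adjacent slabs, in which case the segment between them (inside the convex
cylinder) crosses the common face at a point `q` and
`‖Dv(x) − Dv(y)‖ ≤ C n (|x − q|^{1/2} + |q − y|^{1/2}) ≤ 2 C n |x − y|^{1/2}`; points at distance
`≥ L` are handled by the sup bound, `2 C n ≤ 2 C n (|x − y|/L)^{1/2}`.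

Relation to `PeriodicCylinderSobolevHolder` (landed while this file was written): that file proves
the `1/2`-Hölder bound of the *vorticity* `curl v` on `{r < 1}` (`exists_holderOnWith_curl_unitCylinder`)
through `W^{2,2}(cell) ⊂ C^{0,1/2}`; the present file bounds the full derivative `Dv` (Hölder modulus
and sup) through `W^{3,2}(cell) ⊂ C^{1,1/2}` of `PeriodicCylinderCellC1Half`, and reuses its axial
bookkeeping lemma `apply_two_add_axialShift`.

## References

* R. A. Adams, *Sobolev Spaces*, Academic Press (1975), Thm. 5.4 Parts I–II (p. 89). [Adams1975]
-/

noncomputable section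

open MeasureTheory Set Function Filter Topology TopologicalSpace Metric Module
open scoped ContDiff NNReal ENNReal

namespace Literature.Analysis.FluidPDE

open Literature.Analysis.FunctionSpaces

section Periodic

variable {F : Type*} [NormedAddCommGroup F] [NormedSpace ℝ F]

/-- **The derivative of an axially periodic field is axially periodic**
(`fderiv_comp_add_right`). [folklore] -/
theorem IsAxiallyPeriodic.fderiv {L : ℝ} {v : (EuclideanSpace ℝ (Fin 3)) → F} (hv :
    IsAxiallyPeriodic L v) :
    IsAxiallyPeriodic L (fderiv ℝ v) := by
  intro x
  have h : (fun y => v (y + L • EuclideanSpace.single (2 : Fin 3) (1 : ℝ))) = v := funext hv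
  rw [← fderiv_comp_add_right, h]

/-- The axial coordinate difference is bounded by the distance. [folklore] -/
theorem abs_apply_two_sub_le_norm (x y : (EuclideanSpace ℝ (Fin 3))) : |x 2 - y 2| ≤ ‖x - y‖ := by
  simpa [Real.norm_eq_abs] using PiLp.norm_apply_le (p := 2) (x - y) 2

/-! ### From the open cell to the closed slab `{r < 1, 0 ≤ z ≤ L}` by continuity -/

/-- Shrinking towards mid-height: for `x` with `r(x) < 1` and `0 ≤ z(x) ≤ L`, the points
`x + t (L/2 − z(x)) e_z`, `0 < t < 1`, lie in the open cell and tend to `x` as `t → 0⁺`.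
[folklore] -/
theorem tendsto_shrink_mem_cylinderCell {L : ℝ} (hL : 0 < L) {x : (EuclideanSpace ℝ (Fin 3))} (hxr
    : cylRadius x < 1)
    (hxz : x 2 ∈ Icc 0 L) :
    Tendsto (fun t : ℝ => x + (t * (L / 2 - x 2)) • EuclideanSpace.single (2 : Fin 3) (1 : ℝ))
        (𝓝[>] 0) (𝓝 x) ∧
      ∀ᶠ t : ℝ in 𝓝[>] 0,
        x + (t * (L / 2 - x 2)) • EuclideanSpace.single (2 : Fin 3) (1 : ℝ) ∈
          (cylinderCell L : Set (EuclideanSpace ℝ (Fin 3))) := by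
  constructor
  · have hc : Continuous fun t : ℝ =>
        x + (t * (L / 2 - x 2)) • EuclideanSpace.single (2 : Fin 3) (1 : ℝ) :=
      continuous_const.add ((continuous_id.mul continuous_const).smul continuous_const)
    have h0 := hc.tendsto 0
    simp only [zero_mul, zero_smul, add_zero] at h0
    exact h0.mono_left nhdsWithin_le_nhds
  · filter_upwards [Ioo_mem_nhdsGT one_pos] with t ht
    rw [SetLike.mem_coe, mem_cylinderCell, cylRadius_add_axialShift, apply_two_add_axialShift]
    refine ⟨hxr, ?_, ?_⟩
    · nlinarith [hxz.1, hxz.2, ht.1, ht.2]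
    · nlinarith [hxz.1, hxz.2, ht.1, ht.2]

/-- **Two-point bounds pass from the open cell to the closed slab**: if `g` is continuous on
`{r < 1}` and `‖g x − g y‖ ≤ C |x − y|^{1/2}` on the open cell, the same holds for `x, y` with
`r < 1` and `0 ≤ z ≤ L` (shrink towards mid-height and pass to the limit). [folklore] -/
theorem norm_sub_le_of_cylinderCell_of_mem_slab {G : Type*} [NormedAddCommGroup G] {L : ℝ}
    (hL : 0 < L) {g : (EuclideanSpace ℝ (Fin 3)) → G} (hg : ContinuousOn g (unitCylinder : Set
        (EuclideanSpace ℝ (Fin 3)))) {C : ℝ}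
    (hC : ∀ x ∈ (cylinderCell L : Set (EuclideanSpace ℝ (Fin 3))), ∀ y ∈ (cylinderCell L : Set
        (EuclideanSpace ℝ (Fin 3))),
      ‖g x - g y‖ ≤ C * ‖x - y‖ ^ (1 / 2 : ℝ))
    {x y : (EuclideanSpace ℝ (Fin 3))} (hxr : cylRadius x < 1) (hxz : x 2 ∈ Icc 0 L) (hyr :
        cylRadius y < 1)
    (hyz : y 2 ∈ Icc 0 L) : ‖g x - g y‖ ≤ C * ‖x - y‖ ^ (1 / 2 : ℝ) := by
  obtain ⟨hxT, hxM⟩ := tendsto_shrink_mem_cylinderCell hL hxr hxz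
  obtain ⟨hyT, hyM⟩ := tendsto_shrink_mem_cylinderCell hL hyr hyz
  set φx : ℝ → (EuclideanSpace ℝ (Fin 3)) := fun t => x + (t * (L / 2 - x 2)) •
      EuclideanSpace.single (2 : Fin 3) (1 : ℝ)
  set φy : ℝ → (EuclideanSpace ℝ (Fin 3)) := fun t => y + (t * (L / 2 - y 2)) •
      EuclideanSpace.single (2 : Fin 3) (1 : ℝ)
  have hgx : ContinuousAt g x := hg.continuousAt (unitCylinder.isOpen.mem_nhds hxr)
  have hgy : ContinuousAt g y := hg.continuousAt (unitCylinder.isOpen.mem_nhds hyr)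
  have h1 : Tendsto (fun t => ‖g (φx t) - g (φy t)‖) (𝓝[>] 0) (𝓝 ‖g x - g y‖) :=
    ((hgx.tendsto.comp hxT).sub (hgy.tendsto.comp hyT)).norm
  have h2 : Tendsto (fun t => C * ‖φx t - φy t‖ ^ (1 / 2 : ℝ)) (𝓝[>] 0)
      (𝓝 (C * ‖x - y‖ ^ (1 / 2 : ℝ))) :=
    ((hxT.sub hyT).norm.rpow_const (Or.inr (by norm_num))).const_mul C
  have h3 : ∀ᶠ t in 𝓝[>] 0, ‖g (φx t) - g (φy t)‖ ≤ C * ‖φx t - φy t‖ ^ (1 / 2 : ℝ) := by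
    filter_upwards [hxM, hyM] with t htx hty
    exact hC _ htx _ hty
  exact le_of_tendsto_of_tendsto h1 h2 h3

/-- **One-point bounds pass from the open cell to the closed slab**: if `g` is continuous on
`{r < 1}` and `‖g x‖ ≤ B` on the open cell, then `‖g x‖ ≤ B` for `r(x) < 1`, `0 ≤ z(x) ≤ L`.
[folklore] -/
theorem norm_le_of_cylinderCell_of_mem_slab {G : Type*} [NormedAddCommGroup G] {L : ℝ}
    (hL : 0 < L) {g : (EuclideanSpace ℝ (Fin 3)) → G} (hg : ContinuousOn g (unitCylinder : Set
        (EuclideanSpace ℝ (Fin 3)))) {B : ℝ}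
    (hB : ∀ x ∈ (cylinderCell L : Set (EuclideanSpace ℝ (Fin 3))), ‖g x‖ ≤ B) {x : (EuclideanSpace
        ℝ (Fin 3))} (hxr : cylRadius x < 1)
    (hxz : x 2 ∈ Icc 0 L) : ‖g x‖ ≤ B := by
  obtain ⟨hxT, hxM⟩ := tendsto_shrink_mem_cylinderCell hL hxr hxz
  have hgx : ContinuousAt g x := hg.continuousAt (unitCylinder.isOpen.mem_nhds hxr)
  have h1 : Tendsto (fun t => ‖g (x + (t * (L / 2 - x 2)) •
      EuclideanSpace.single (2 : Fin 3) (1 : ℝ))‖) (𝓝[>] 0) (𝓝 ‖g x‖) :=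
    (hgx.tendsto.comp hxT).norm
  exact le_of_tendsto_of_tendsto h1 tendsto_const_nhds (hxM.mono fun t ht => hB _ ht)

/-! ### Crossing a face of a slab inside the convex cylinder -/

/-- **Crossing point**: for `a, b` in the open cylinder and a level `c` between `z(a)` and `z(b)`,
the segment `[a, b]` (inside the convex cylinder) contains a point `q` with `z(q) = c`, and both
pieces are no longer than the segment. [folklore] -/
theorem exists_mem_unitCylinder_apply_two_eq {a b : (EuclideanSpace ℝ (Fin 3))} (ha : a ∈
    (unitCylinder : Set (EuclideanSpace ℝ (Fin 3))))
    (hb : b ∈ (unitCylinder : Set (EuclideanSpace ℝ (Fin 3)))) {c : ℝ} (hac : a 2 ≤ c) (hcb : c ≤ b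
        2) :
    ∃ q ∈ (unitCylinder : Set (EuclideanSpace ℝ (Fin 3))), q 2 = c ∧ ‖a - q‖ ≤ ‖a - b‖ ∧ ‖q - b‖ ≤
        ‖a - b‖ := by
  rcases eq_or_lt_of_le (hac.trans hcb) with hab | hab
  · -- `z(a) = z(b)`, hence `c = z(a)`: take `q = a`
    refine ⟨a, ha, le_antisymm hac (hcb.trans hab.symm.le), ?_, ?_⟩
    · simp
    · exact le_rfl
  · set θ : ℝ := (c - a 2) / (b 2 - a 2) with hθ
    have hden : 0 < b 2 - a 2 := by linarith
    have hθ0 : 0 ≤ θ := div_nonneg (by linarith) hden.le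
    have hθ1 : θ ≤ 1 := by rw [hθ, div_le_one hden]; linarith
    refine ⟨a + θ • (b - a), convex_unitCylinder.add_smul_sub_mem ha hb ⟨hθ0, hθ1⟩, ?_, ?_, ?_⟩
    · simp only [PiLp.add_apply, PiLp.smul_apply, PiLp.sub_apply, smul_eq_mul, hθ]
      field_simp
      ring
    · rw [show a - (a + θ • (b - a)) = -(θ • (b - a)) by abel, norm_neg, norm_smul,
        Real.norm_of_nonneg hθ0, norm_sub_rev]
      exact mul_le_of_le_one_left (norm_nonneg _) hθ1
    · rw [show a + θ • (b - a) - b = (1 - θ) • (a - b) by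
        simp only [sub_smul, one_smul, smul_sub]; abel, norm_smul, Real.norm_of_nonneg (by
            linarith)]
      exact mul_le_of_le_one_left (norm_nonneg _) (by linarith)

/-! ### The imbedding on the whole cylinder -/

variable [CompleteSpace F] [FiniteDimensional ℝ F]

/-- **`W^{3,2} ⊂ C^{1,1/2}` on the periodic cylinder** (Adams, *Sobolev Spaces* (1975), Thm. 5.4
Part II Case C' (9) with the sup bound of Part I Case C (8), `n = 3`, `m = p = 2`, `j = 1`,
`λ = 1/2`, on the period cell, carried to the infinite cylinder by periodicity and continuity):
for `L > 0` there is `C = C(L)` such that every field `v` smooth on the closed cylinder `{r ≤ 1}`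
and `L`-periodic in `z`, with `‖v‖_{W^{3,2}(cell)} ≤ n`, satisfies
`‖Dv(x) − Dv(y)‖ ≤ C n |x − y|^{1/2}` and `‖Dv(x)‖ ≤ C n` for all `x, y` with `r < 1`.
[cite: Adams1975, Thm. 5.4 Part II Case C' (9) and Part I Case C (8) (p. 89)] -/
theorem periodicCylinder_fderiv_holderHalf_norm_le {L : ℝ} (hL : 0 < L) :
    ∃ C : ℝ≥0, ∀ (v : (EuclideanSpace ℝ (Fin 3)) → F), ContDiffOn ℝ ∞ v (closure (unitCylinder :
        Set (EuclideanSpace ℝ (Fin 3)))) →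
      IsAxiallyPeriodic L v → ∀ n : ℝ≥0, eSobolevDomainNorm 3 2 (cylinderCell L) volume v ≤ n →
      (∀ x ∈ (unitCylinder : Set (EuclideanSpace ℝ (Fin 3))), ∀ y ∈ (unitCylinder : Set
          (EuclideanSpace ℝ (Fin 3))),
          ‖fderiv ℝ v x - fderiv ℝ v y‖ ≤ C * n * ‖x - y‖ ^ (1 / 2 : ℝ)) ∧
      ∀ x ∈ (unitCylinder : Set (EuclideanSpace ℝ (Fin 3))), ‖fderiv ℝ v x‖ ≤ C * n := by
  obtain ⟨C_H, hC_H⟩ := cylinderCell_fderiv_holderHalf (F := F) hL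
  obtain ⟨C_S, hC_S⟩ := cylinderCell_norm_fderiv_le (F := F) L
  -- the constant of the far pairs, `2 C_S / √L`
  set κ : ℝ≥0 := ((Real.sqrt L)⁻¹).toNNReal with hκ
  have hκ' : (κ : ℝ) = (Real.sqrt L)⁻¹ := Real.coe_toNNReal _ (by positivity)
  refine ⟨2 * C_H + 2 * C_S * κ + C_S, fun v hv hper n hn => ?_⟩
  set e : (EuclideanSpace ℝ (Fin 3)) := EuclideanSpace.single (2 : Fin 3) (1 : ℝ) with he
  set g := fderiv ℝ v with hg_def
  have hvU : ContDiffOn ℝ ∞ v (unitCylinder : Set (EuclideanSpace ℝ (Fin 3))) := hv.mono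
      subset_closure
  have hgc : ContinuousOn g (unitCylinder : Set (EuclideanSpace ℝ (Fin 3))) :=
    hvU.continuousOn_fderiv_of_isOpen unitCylinder.isOpen (by simp)
  have hgper : IsAxiallyPeriodic L g := hper.fderiv
  have hvcell : ContDiffOn ℝ ∞ v (cylinderCell L : Set (EuclideanSpace ℝ (Fin 3))) :=
    hv.mono (subset_closure.trans (closure_cylinderCell_subset L))
  -- the cell bounds and their extension to the closed slab
  have hcellH := hC_H v hvcell n hn
  have hcellS := hC_S v hvcell n hn
  have hslabH : ∀ x y : (EuclideanSpace ℝ (Fin 3)), cylRadius x < 1 → x 2 ∈ Icc 0 L → cylRadius y <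
      1 → y 2 ∈ Icc 0 L →
      ‖g x - g y‖ ≤ C_H * n * ‖x - y‖ ^ (1 / 2 : ℝ) := fun x y hxr hxz hyr hyz =>
    norm_sub_le_of_cylinderCell_of_mem_slab hL hgc hcellH hxr hxz hyr hyz
  have hslabS : ∀ x : (EuclideanSpace ℝ (Fin 3)), cylRadius x < 1 → x 2 ∈ Icc 0 L → ‖g x‖ ≤ C_S * n
      :=
    fun x hxr hxz => norm_le_of_cylinderCell_of_mem_slab hL hgc hcellS hxr hxz
  -- periodicity: the bounds in every slab `{jL ≤ z ≤ (j+1)L}`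
  have hshift : ∀ (j : ℤ) (a : (EuclideanSpace ℝ (Fin 3))), g (a + (((-j : ℤ) : ℝ) * L) • e) = g a
      := fun j a =>
    hgper.add_int_mul (-j) a
  have hslabjH : ∀ (j : ℤ) (a b : (EuclideanSpace ℝ (Fin 3))), cylRadius a < 1 → cylRadius b < 1 →
      (j : ℝ) * L ≤ a 2 → a 2 ≤ ((j : ℝ) + 1) * L → (j : ℝ) * L ≤ b 2 → b 2 ≤ ((j : ℝ) + 1) * L →
      ‖g a - g b‖ ≤ C_H * n * ‖a - b‖ ^ (1 / 2 : ℝ) := by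
    intro j a b har hbr ha1 ha2 hb1 hb2
    have key := hslabH (a + (((-j : ℤ) : ℝ) * L) • e) (b + (((-j : ℤ) : ℝ) * L) • e)
      (by rw [he, cylRadius_add_axialShift]; exact har)
      (by rw [he, apply_two_add_axialShift]; push_cast; constructor <;> linarith)
      (by rw [he, cylRadius_add_axialShift]; exact hbr)
      (by rw [he, apply_two_add_axialShift]; push_cast; constructor <;> linarith)
    rwa [hshift, hshift, add_sub_add_right_eq_sub] at key
  have hsupU : ∀ x ∈ (unitCylinder : Set (EuclideanSpace ℝ (Fin 3))), ‖g x‖ ≤ C_S * n := by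
    intro x hx
    set j : ℤ := ⌊x 2 / L⌋ with hj
    have hj1 : (j : ℝ) * L ≤ x 2 := (le_div_iff₀ hL).1 (Int.floor_le _)
    have hj2 : x 2 < ((j : ℝ) + 1) * L := (div_lt_iff₀ hL).1 (Int.lt_floor_add_one _)
    have key := hslabS (x + (((-j : ℤ) : ℝ) * L) • e)
      (by rw [he, cylRadius_add_axialShift]; exact hx)
      (by rw [he, apply_two_add_axialShift]; push_cast; constructor <;> linarith)
    rwa [hshift] at key
  have hn0 : (0 : ℝ) ≤ n := n.coe_nonneg
  refine ⟨fun x hx y hy => ?_, fun x hx => (hsupU x hx).trans ?_⟩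
  · -- the two-point bound
    have hxr : cylRadius x < 1 := hx
    have hyr : cylRadius y < 1 := hy
    set d : ℝ := ‖x - y‖ with hd
    have hd0 : 0 ≤ d := norm_nonneg _
    have hcoef : (2 * C_H + 2 * C_S * κ : ℝ) ≤ ((2 * C_H + 2 * C_S * κ + C_S : ℝ≥0) : ℝ) := by
      push_cast; linarith [C_S.coe_nonneg]
    have hCle : ∀ {t : ℝ}, t ≤ (2 * C_H + 2 * C_S * κ : ℝ) * n * d ^ (1 / 2 : ℝ) →
        t ≤ ((2 * C_H + 2 * C_S * κ + C_S : ℝ≥0) : ℝ) * n * d ^ (1 / 2 : ℝ) := fun ht =>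
      ht.trans (mul_le_mul_of_nonneg_right (mul_le_mul_of_nonneg_right hcoef hn0) (by positivity))
    by_cases hfar : L ≤ d
    · -- far pairs: the sup bound
      refine hCle ?_
      have hsq : 1 ≤ (κ : ℝ) * d ^ (1 / 2 : ℝ) := by
        rw [hκ', ← Real.sqrt_eq_rpow, ← Real.sqrt_inv, ← Real.sqrt_mul (by positivity),
          Real.one_le_sqrt, inv_mul_eq_div, one_le_div hL]
        exact hfar
      calc ‖g x - g y‖ ≤ ‖g x‖ + ‖g y‖ := norm_sub_le _ _
        _ ≤ C_S * n + C_S * n := add_le_add (hsupU x hx) (hsupU y hy)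
        _ = 2 * C_S * n * 1 := by ring
        _ ≤ 2 * C_S * n * ((κ : ℝ) * d ^ (1 / 2 : ℝ)) := by gcongr
        _ ≤ (2 * C_H + 2 * C_S * κ : ℝ) * n * d ^ (1 / 2 : ℝ) := by
            have : 0 ≤ 2 * (C_H : ℝ) * n * d ^ (1 / 2 : ℝ) := by positivity
            linarith
    · -- close pairs: same or adjacent slabs
      have hdL : d < L := not_le.1 hfar
      set j : ℤ := ⌊x 2 / L⌋ with hj
      have hj1 : (j : ℝ) * L ≤ x 2 := (le_div_iff₀ hL).1 (Int.floor_le _)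
      have hj2 : x 2 < ((j : ℝ) + 1) * L := (div_lt_iff₀ hL).1 (Int.lt_floor_add_one _)
      have hxy2 : |x 2 - y 2| ≤ d := abs_apply_two_sub_le_norm x y
      have hxy2' := abs_le.1 hxy2
      have hpow : ∀ {s : ℝ}, 0 ≤ s → s ≤ d → s ^ (1 / 2 : ℝ) ≤ d ^ (1 / 2 : ℝ) := fun hs hsd =>
        Real.rpow_le_rpow hs hsd (by norm_num)
      refine hCle ?_
      have htwo : ∀ {t : ℝ}, t ≤ 2 * (C_H * n * d ^ (1 / 2 : ℝ)) →
          t ≤ (2 * C_H + 2 * C_S * κ : ℝ) * n * d ^ (1 / 2 : ℝ) := fun ht =>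
        ht.trans (by
          have : 0 ≤ 2 * (C_S : ℝ) * κ * n * d ^ (1 / 2 : ℝ) := by positivity
          linarith)
      by_cases hy1 : (j : ℝ) * L ≤ y 2
      · by_cases hy2 : y 2 ≤ ((j : ℝ) + 1) * L
        · -- same slab
          refine htwo ((hslabjH j x y hxr hyr hj1 hj2.le hy1 hy2).trans ?_)
          have : 0 ≤ (C_H : ℝ) * n * d ^ (1 / 2 : ℝ) := by positivity
          linarith
        · -- `y` in the slab above: cross the face `z = (j+1)L`
          have hy2' : ((j : ℝ) + 1) * L < y 2 := not_le.1 hy2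
          obtain ⟨q, hqU, hq2, hq1n, hq2n⟩ :=
            exists_mem_unitCylinder_apply_two_eq hx hy hj2.le hy2'.le
          have hqr : cylRadius q < 1 := hqU
          have h1 : ‖g x - g q‖ ≤ C_H * n * ‖x - q‖ ^ (1 / 2 : ℝ) :=
            hslabjH j x q hxr hqr hj1 hj2.le (by rw [hq2]; linarith) (by rw [hq2])
          have h2 : ‖g q - g y‖ ≤ C_H * n * ‖q - y‖ ^ (1 / 2 : ℝ) :=
            hslabjH (j + 1) q y hqr hyr (by rw [hq2]; push_cast; linarith)
              (by rw [hq2]; push_cast; linarith) (by push_cast; linarith) (by push_cast; linarith)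
          refine htwo ?_
          calc ‖g x - g y‖ ≤ ‖g x - g q‖ + ‖g q - g y‖ := norm_sub_le_norm_sub_add_norm_sub _ _ _
            _ ≤ C_H * n * ‖x - q‖ ^ (1 / 2 : ℝ) + C_H * n * ‖q - y‖ ^ (1 / 2 : ℝ) := add_le_add h1
                h2
            _ ≤ C_H * n * d ^ (1 / 2 : ℝ) + C_H * n * d ^ (1 / 2 : ℝ) :=
                add_le_add (mul_le_mul_of_nonneg_left (hpow (norm_nonneg _) hq1n) (by positivity))
                  (mul_le_mul_of_nonneg_left (hpow (norm_nonneg _) hq2n) (by positivity))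
            _ = 2 * (C_H * n * d ^ (1 / 2 : ℝ)) := by ring
      · -- `y` in the slab below: cross the face `z = jL`
        have hy1' : y 2 < (j : ℝ) * L := not_le.1 hy1
        obtain ⟨q, hqU, hq2, hq1n, hq2n⟩ :=
          exists_mem_unitCylinder_apply_two_eq hy hx hy1'.le hj1
        have hqr : cylRadius q < 1 := hqU
        have h1 : ‖g y - g q‖ ≤ C_H * n * ‖y - q‖ ^ (1 / 2 : ℝ) :=
          hslabjH (j - 1) y q hyr hqr (by push_cast; linarith) (by push_cast; linarith)
            (by rw [hq2]; push_cast; linarith) (by rw [hq2]; push_cast; linarith)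
        have h2 : ‖g q - g x‖ ≤ C_H * n * ‖q - x‖ ^ (1 / 2 : ℝ) :=
          hslabjH j q x hqr hxr (by rw [hq2]) (by rw [hq2]; linarith) hj1 hj2.le
        refine htwo ?_
        have hdyx : ‖y - x‖ = d := norm_sub_rev _ _
        calc ‖g x - g y‖ = ‖g y - g x‖ := norm_sub_rev _ _
          _ ≤ ‖g y - g q‖ + ‖g q - g x‖ := norm_sub_le_norm_sub_add_norm_sub _ _ _
          _ ≤ C_H * n * ‖y - q‖ ^ (1 / 2 : ℝ) + C_H * n * ‖q - x‖ ^ (1 / 2 : ℝ) := add_le_add h1 h2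
          _ ≤ C_H * n * d ^ (1 / 2 : ℝ) + C_H * n * d ^ (1 / 2 : ℝ) :=
              add_le_add
                (mul_le_mul_of_nonneg_left (hpow (norm_nonneg _) (hdyx ▸ hq1n)) (by positivity))
                (mul_le_mul_of_nonneg_left (hpow (norm_nonneg _) (hdyx ▸ hq2n)) (by positivity))
          _ = 2 * (C_H * n * d ^ (1 / 2 : ℝ)) := by ring
  · -- the sup bound
    push_cast
    have : 0 ≤ (2 * C_H + 2 * C_S * κ : ℝ) * n := by positivity
    linarith

end Periodic

end Literature.Analysis.FluidPDE
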